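import Mathlib
import HarnessLib

/-!
# Periodisation — `stub_periodisation` (stub PER) of line `swap-odd-threshold-rigidity`
(crux `EmbeddedDrudeMourre.MourreDissolution`, item stmt-AtomisticToContinuum-12594; helper file,
`--supports`)

Registered stub PER of the checked skeleton of line `swap-odd-threshold-rigidity`, in the
skeleton's stub namespace `Summit.AtomisticToContinuum.FouriersLaw.Theorems.MourreDissolution`.

Statement. For a measurable `F : ℝ × ℝ × ℝ → ℝ≥0∞` which is `2π`-periodic in each of the three
coordinates, the integral of `F` over the period cell `(−π,π]³` equals the integral over `ℝ³` of
`ψ · F`, where `ψ p = Λ p.1 · Λ p.2.1 · Λ p.2.2` is the continuous hat weight built from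
`Λ t = max 0 (1 − |t| / 2π)` (which satisfies `Σₙ Λ (t + 2πn) = 1`).

Proof (pure measure theory, Mathlib only).
* One variable (`periodise_one_dim`): `Λ` vanishes off `(−2π, 2π]`, so
  `∫⁻ Λ g = ∫⁻_{(−2π,0]} Λ g + ∫⁻_{(0,2π]} Λ g`; translating the first piece by `2π`
  (Lebesgue measure is translation invariant, `g` is periodic) and using
  `Λ (t − 2π) + Λ t = 1` on `(0, 2π]` gives `∫⁻_{(0,2π]} g`, which equals `∫⁻_{(−π,π]} g` since
  both are the integral of the periodic lift of `g` over `AddCircle (2π)`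
  (`AddCircle.lintegral_preimage`).
* Two and three variables (`periodise_two_dim`, `periodise_three_dim`): Tonelli
  (`setLIntegral_prod`, `lintegral_prod`), the one-variable identity in the innermost variable, then
  in the outer variable applied to the (measurable, periodic) partial integral, and
  `lintegral_const_mul` to reassemble the product weight.
-/

noncomputable section

namespace Summit.AtomisticToContinuum.FouriersLaw.Theorems.MourreDissolution

open MeasureTheory Set Real
open scoped ENNReal

/-! ### The hat weight -/

/-- The hat weight is continuous. [folklore] -/
theorem periodise_hat_continuous : Continuous fun t : ℝ => max 0 (1 - |t| / (2 * π)) := by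
  fun_prop

/-- `ofReal ∘ Λ` is measurable. [folklore] -/
theorem periodise_hat_measurable : Measurable fun t => ENNReal.ofReal (max 0 (1 - |t| / (2 * π))) :=
  ENNReal.measurable_ofReal.comp periodise_hat_continuous.measurable

/-- The hat weight is non-negative. [folklore] -/
theorem periodise_hat_nonneg (t : ℝ) : 0 ≤ max 0 (1 - |t| / (2 * π)) := le_max_left _ _

/-- The hat weight vanishes where `2π ≤ |t|`. [folklore] -/
theorem periodise_hat_eq_zero {t : ℝ} (ht : 2 * π ≤ |t|) : max 0 (1 - |t| / (2 * π)) = 0 := by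
  apply max_eq_left
  rw [sub_nonpos, le_div_iff₀ two_pi_pos, one_mul]
  exact ht

/-- `Λ · g` is supported in `(−2π, 2π]`. [folklore] -/
theorem periodise_hat_support_subset (g : ℝ → ℝ≥0∞) :
    Function.support (fun t => ENNReal.ofReal (max 0 (1 - |t| / (2 * π))) * g t) ⊆
      Ioc (-(2 * π)) (2 * π) := by
  intro t ht
  rw [Function.mem_support, mul_ne_zero_iff] at ht
  have h1 := ht.1
  rw [Ne, ENNReal.ofReal_eq_zero, not_le] at h1
  by_contra hmem
  apply h1.ne'
  apply periodise_hat_eq_zero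
  rw [mem_Ioc, not_and_or, not_lt, not_le] at hmem
  rcases hmem with h | h
  · rw [abs_of_neg (by linarith [two_pi_pos])]
    linarith
  · rw [abs_of_pos (by linarith [two_pi_pos])]
    linarith

/-- Partition of unity on one period: `Λ (t − 2π) + Λ t = 1` for `t ∈ (0, 2π]`. [folklore] -/
theorem periodise_hat_add {t : ℝ} (ht : t ∈ Ioc 0 (2 * π)) :
    max 0 (1 - |t - 2 * π| / (2 * π)) + max 0 (1 - |t| / (2 * π)) = 1 := by
  have h2 : 0 < 2 * π := two_pi_pos
  rw [abs_of_nonpos (by linarith [ht.2]), abs_of_pos ht.1, max_eq_right, max_eq_right]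
  · field_simp
    ring
  · rw [sub_nonneg, div_le_one h2]
    exact ht.2
  · rw [sub_nonneg, div_le_one h2]
    linarith [ht.1]

/-! ### One variable -/

/-- One-dimensional periodisation: for a measurable `2π`-periodic `g : ℝ → ℝ≥0∞`,
`∫⁻_{(−π,π]} g = ∫⁻ Λ · g`. [folklore] -/
theorem periodise_one_dim (g : ℝ → ℝ≥0∞) (hg : Measurable g)
    (hper : ∀ t, g (t + 2 * π) = g t) :
    ∫⁻ t in Ioc (-π) π, g t = ∫⁻ t, ENNReal.ofReal (max 0 (1 - |t| / (2 * π))) * g t := by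
  have h2 : 0 < 2 * π := two_pi_pos
  -- restrict the right-hand side to `(−2π, 2π]` and split at `0`
  rw [← setLIntegral_eq_of_support_subset (periodise_hat_support_subset g),
    ← Ioc_union_Ioc_eq_Ioc (b := 0) (by linarith) h2.le,
    lintegral_union measurableSet_Ioc (Ioc_disjoint_Ioc_of_le le_rfl)]
  -- translate the first piece by `2π`
  have hshift : ∫⁻ t in Ioc (-(2 * π)) 0, ENNReal.ofReal (max 0 (1 - |t| / (2 * π))) * g t =
      ∫⁻ t in Ioc 0 (2 * π), ENNReal.ofReal (max 0 (1 - |t - 2 * π| / (2 * π))) * g t := by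
    have := (measurePreserving_sub_right (volume : Measure ℝ) (2 * π)).setLIntegral_comp_preimage
      (s := Ioc (-(2 * π)) 0) measurableSet_Ioc
      (f := fun t => ENNReal.ofReal (max 0 (1 - |t| / (2 * π))) * g t)
      (periodise_hat_measurable.mul hg)
    rw [← this, preimage_sub_const_Ioc, neg_add_cancel, zero_add]
    refine setLIntegral_congr_fun measurableSet_Ioc fun t _ => ?_
    rw [show g (t - 2 * π) = g t by rw [← hper (t - 2 * π), sub_add_cancel]]
  have hmeas : Measurable fun t => ENNReal.ofReal (max 0 (1 - |t - 2 * π| / (2 * π))) * g t :=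
    (periodise_hat_measurable.comp (measurable_id.sub_const _)).mul hg
  rw [hshift, ← lintegral_add_left hmeas]
  have hsum : ∫⁻ t in Ioc 0 (2 * π), ENNReal.ofReal (max 0 (1 - |t - 2 * π| / (2 * π))) * g t +
      ENNReal.ofReal (max 0 (1 - |t| / (2 * π))) * g t = ∫⁻ t in Ioc 0 (2 * π), g t := by
    refine setLIntegral_congr_fun measurableSet_Ioc fun t ht => ?_
    rw [← add_mul, ← ENNReal.ofReal_add (periodise_hat_nonneg _) (periodise_hat_nonneg _),
      periodise_hat_add ht, ENNReal.ofReal_one, one_mul]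
  rw [hsum]
  -- both cells `(−π, π]` and `(0, 2π]` are fundamental domains of the period lattice
  haveI : Fact (0 < 2 * π) := ⟨h2⟩
  have hp : Function.Periodic g (2 * π) := hper
  have e1 := AddCircle.lintegral_preimage (2 * π) (-π) hp.lift
  have e2 := AddCircle.lintegral_preimage (2 * π) 0 hp.lift
  simp only [Function.Periodic.lift_coe] at e1 e2
  rw [show -π + 2 * π = π by ring] at e1
  rw [zero_add] at e2
  rw [e1, e2]

/-! ### Two and three variables -/

/-- The product hat weight on `ℝ × ℝ` is measurable (as an `ℝ≥0∞`-valued function). [folklore] -/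
theorem periodise_hat_measurable₂ :
    Measurable fun q : ℝ × ℝ =>
      ENNReal.ofReal (max 0 (1 - |q.1| / (2 * π)) * max 0 (1 - |q.2| / (2 * π))) :=
  ENNReal.measurable_ofReal.comp
    ((periodise_hat_continuous.measurable.comp measurable_fst).mul
      (periodise_hat_continuous.measurable.comp measurable_snd))

/-- The product hat weight on `ℝ × ℝ × ℝ` is measurable (as an `ℝ≥0∞`-valued function).
[folklore] -/
theorem periodise_hat_measurable₃ :
    Measurable fun p : ℝ × ℝ × ℝ =>
      ENNReal.ofReal (max 0 (1 - |p.1| / (2 * π)) *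
        (max 0 (1 - |p.2.1| / (2 * π)) * max 0 (1 - |p.2.2| / (2 * π)))) :=
  ENNReal.measurable_ofReal.comp
    ((periodise_hat_continuous.measurable.comp measurable_fst).mul
      ((periodise_hat_continuous.measurable.comp (measurable_fst.comp measurable_snd)).mul
        (periodise_hat_continuous.measurable.comp (measurable_snd.comp measurable_snd))))

/-- Two-dimensional periodisation: for a measurable `H : ℝ × ℝ → ℝ≥0∞`, `2π`-periodic in both
coordinates, `∫⁻_{(−π,π]²} H = ∫⁻ (Λ ⊗ Λ) · H`. [folklore] -/
theorem periodise_two_dim (H : ℝ × ℝ → ℝ≥0∞) (hH : Measurable H)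
    (hy : ∀ y z, H (y + 2 * π, z) = H (y, z)) (hz : ∀ y z, H (y, z + 2 * π) = H (y, z)) :
    ∫⁻ q in Ioc (-π) π ×ˢ Ioc (-π) π, H q =
      ∫⁻ q, ENNReal.ofReal (max 0 (1 - |q.1| / (2 * π)) * max 0 (1 - |q.2| / (2 * π))) * H q := by
  have m1 : ∀ y, Measurable fun z => H (y, z) := fun y => hH.comp measurable_prodMk_left
  have m2 : ∀ y, Measurable fun z => ENNReal.ofReal (max 0 (1 - |z| / (2 * π))) * H (y, z) :=
    fun y => periodise_hat_measurable.mul (m1 y)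
  have m3 : Measurable fun y => ∫⁻ z, ENNReal.ofReal (max 0 (1 - |z| / (2 * π))) * H (y, z) :=
    ((periodise_hat_measurable.comp measurable_snd).mul hH).lintegral_prod_right'
  have step1 : ∀ y, ∫⁻ z in Ioc (-π) π, H (y, z) =
      ∫⁻ z, ENNReal.ofReal (max 0 (1 - |z| / (2 * π))) * H (y, z) :=
    fun y => periodise_one_dim _ (m1 y) (fun z => hz y z)
  have step2 : ∫⁻ y in Ioc (-π) π, ∫⁻ z, ENNReal.ofReal (max 0 (1 - |z| / (2 * π))) * H (y, z) =
      ∫⁻ y, ENNReal.ofReal (max 0 (1 - |y| / (2 * π))) *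
        ∫⁻ z, ENNReal.ofReal (max 0 (1 - |z| / (2 * π))) * H (y, z) :=
    periodise_one_dim _ m3 (fun y => by simp_rw [hy])
  rw [Measure.volume_eq_prod, setLIntegral_prod _ hH.aemeasurable]
  simp_rw [step1]
  rw [step2, lintegral_prod
    (fun q : ℝ × ℝ =>
      ENNReal.ofReal (max 0 (1 - |q.1| / (2 * π)) * max 0 (1 - |q.2| / (2 * π))) * H q)
    (periodise_hat_measurable₂.mul hH).aemeasurable]
  refine lintegral_congr fun y => ?_
  rw [← lintegral_const_mul _ (m2 y)]
  refine lintegral_congr fun z => ?_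
  show _ = ENNReal.ofReal (max 0 (1 - |y| / (2 * π)) * max 0 (1 - |z| / (2 * π))) * H (y, z)
  rw [ENNReal.ofReal_mul (periodise_hat_nonneg y), mul_assoc]

/-- Three-dimensional periodisation (curried periodicity hypotheses). [folklore] -/
theorem periodise_three_dim (F : ℝ × ℝ × ℝ → ℝ≥0∞) (hF : Measurable F)
    (h1 : ∀ x (q : ℝ × ℝ), F (x + 2 * π, q) = F (x, q))
    (h2 : ∀ x y z, F (x, y + 2 * π, z) = F (x, y, z))
    (h3 : ∀ x y z, F (x, y, z + 2 * π) = F (x, y, z)) :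
    ∫⁻ p in Ioc (-π) π ×ˢ (Ioc (-π) π ×ˢ Ioc (-π) π), F p =
      ∫⁻ p, ENNReal.ofReal
        (max 0 (1 - |p.1| / (2 * π)) *
          (max 0 (1 - |p.2.1| / (2 * π)) * max 0 (1 - |p.2.2| / (2 * π)))) * F p := by
  have mF : ∀ x, Measurable fun q : ℝ × ℝ => F (x, q) := fun x => hF.comp measurable_prodMk_left
  have mW : ∀ x, Measurable fun q : ℝ × ℝ =>
      ENNReal.ofReal (max 0 (1 - |q.1| / (2 * π)) * max 0 (1 - |q.2| / (2 * π))) * F (x, q) :=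
    fun x => periodise_hat_measurable₂.mul (mF x)
  have mG : Measurable fun x =>
      ∫⁻ q, ENNReal.ofReal (max 0 (1 - |q.1| / (2 * π)) * max 0 (1 - |q.2| / (2 * π))) * F (x, q) :=
    ((periodise_hat_measurable₂.comp measurable_snd).mul hF).lintegral_prod_right'
  have step1 : ∀ x, ∫⁻ q in Ioc (-π) π ×ˢ Ioc (-π) π, F (x, q) =
      ∫⁻ q, ENNReal.ofReal (max 0 (1 - |q.1| / (2 * π)) * max 0 (1 - |q.2| / (2 * π))) * F (x, q) :=
    fun x => periodise_two_dim (fun q => F (x, q)) (mF x) (h2 x) (h3 x)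
  have step2 : ∫⁻ x in Ioc (-π) π,
      ∫⁻ q, ENNReal.ofReal (max 0 (1 - |q.1| / (2 * π)) * max 0 (1 - |q.2| / (2 * π))) * F (x, q) =
      ∫⁻ x, ENNReal.ofReal (max 0 (1 - |x| / (2 * π))) *
        ∫⁻ q, ENNReal.ofReal (max 0 (1 - |q.1| / (2 * π)) * max 0 (1 - |q.2| / (2 * π))) *
          F (x, q) :=
    periodise_one_dim _ mG (fun x => by simp_rw [h1])
  rw [Measure.volume_eq_prod, setLIntegral_prod _ hF.aemeasurable]
  simp_rw [step1]
  rw [step2, lintegral_prod (fun p : ℝ × ℝ × ℝ => ENNReal.ofReal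
    (max 0 (1 - |p.1| / (2 * π)) *
      (max 0 (1 - |p.2.1| / (2 * π)) * max 0 (1 - |p.2.2| / (2 * π)))) * F p)
    (periodise_hat_measurable₃.mul hF).aemeasurable]
  refine lintegral_congr fun x => ?_
  rw [← lintegral_const_mul _ (mW x)]
  refine lintegral_congr fun q => ?_
  show _ = ENNReal.ofReal (max 0 (1 - |x| / (2 * π)) *
    (max 0 (1 - |q.1| / (2 * π)) * max 0 (1 - |q.2| / (2 * π)))) * F (x, q)
  rw [ENNReal.ofReal_mul (periodise_hat_nonneg x), mul_assoc]

/-! ### The registered stub -/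

/-- **Stub PER (periodisation).** For a measurable `F : ℝ × ℝ × ℝ → ℝ≥0∞` which is
`2π`-periodic in each coordinate, the integral of `F` over the cell `(−π,π]³` equals the
integral over `ℝ³` of `ψ · F` with the hat weight
`ψ p = Λ p.1 · Λ p.2.1 · Λ p.2.2`, `Λ t = max 0 (1 − |t| / 2π)`. [folklore] -/
theorem stub_periodisation :
    ∀ F : ℝ × ℝ × ℝ → ENNReal, Measurable F →
      (∀ p : ℝ × ℝ × ℝ, F (p.1 + 2 * Real.pi, p.2) = F p) →
      (∀ p : ℝ × ℝ × ℝ, F (p.1, p.2.1 + 2 * Real.pi, p.2.2) = F p) →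
      (∀ p : ℝ × ℝ × ℝ, F (p.1, p.2.1, p.2.2 + 2 * Real.pi) = F p) →
      ∫⁻ p in Set.Ioc (-Real.pi) Real.pi ×ˢ (Set.Ioc (-Real.pi) Real.pi ×ˢ Set.Ioc (-Real.pi) Real.pi), F p =
        ∫⁻ p : ℝ × ℝ × ℝ, ENNReal.ofReal (max 0 (1 - |p.1| / (2 * Real.pi)) *
          (max 0 (1 - |p.2.1| / (2 * Real.pi)) * max 0 (1 - |p.2.2| / (2 * Real.pi)))) * F p := by
  intro F hF h1 h2 h3
  exact periodise_three_dim F hF (fun x q => h1 (x, q)) (fun x y z => h2 (x, y, z))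
    (fun x y z => h3 (x, y, z))

end Summit.AtomisticToContinuum.FouriersLaw.Theorems.MourreDissolution
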